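import Summits.BirchSwinnertonDyer.BirchSwinnertonDyer.Theorems.ResidualThetaTransportAtTwoResidualSignedLambdaLowerCMAtTwoRelaxedDeepHalf
import HarnessLib

/-!
# stub-critic g12 certificates (U37/U38) — k1-g9's PLACE CUT transposed to the carriers of the LANDED
# `CharIdealLambda.deepHalfSigma_of_relaxed` (p673742): values in `AddCircle` through `CharacterModule`
# (contravariant scalar action `(a • φ) d = φ (a • d)`), not an abstract value module `Q`.

Nothing here proves RSL_g (stmt-22608), the crux 26074 or BSD. Scratch certificates of the critic; not a proposal.

* `hDHrel_of_placeCut` (U37): S4₂ (at 2, output `S₀`-value zero) ∧ S4₀ (away from 2, tested on `ker loc₂`) ∧ EH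
  (SelRel-wide reciprocity) ⟹ the binder `hDHrel` of `deepHalfSigma_of_relaxed` VERBATIM with `loc' := ld₂.prod ldS`.
  `StrictKilled` is `map_zero` on these carriers. The scalar bookkeeping differs from k1-g9 §A: one evaluates the
  orthogonality hypothesis at `a₀ • s` instead of multiplying values (values carry no `A`-action).
* `atTwo_of_hDHrel` (U37′): the converse slice (`χ = 0`), no hypothesis.
* `pair_locd_eq_zero_of_reciprocity` (U38): SelRel-wide EH ⟹ `pair (locd x) = 0` for EVERY `x : H` under p673742's
  `hcompat`/`hloc` — hence p673478's first conjunct `(EH_Z)` for any `Z`.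
-/

set_option autoImplicit false
set_option linter.dupNamespace false

namespace Summit.BirchSwinnertonDyer.BirchSwinnertonDyer.Cruxes.ResidualThetaCountLowerPureAtTwo.ScritG12

universe u v

variable {A : Type u} [CommRing A]
  {P₀ : Type v} [AddCommGroup P₀] [Module A P₀]
  {PS : Type v} [AddCommGroup PS] [Module A PS]
  {D₂ : Type v} [AddCommGroup D₂] [Module A D₂]
  {DS : Type v} [AddCommGroup DS] [Module A DS]
  {P : Type v} [AddCommGroup P] [Module A P]
  {H : Type v} [AddCommGroup H] [Module A H]
  {SelRel : Type v} [AddCommGroup SelRel] [Module A SelRel]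

/-- **U37.** Place cut ⟹ `hDHrel` of p673742, on its own carriers. [folklore] -/
theorem hDHrel_of_placeCut [NoZeroDivisors A]
    (c₂ : P₀ →ₗ[A] CharacterModule D₂) (cS : PS →ₗ[A] CharacterModule DS)
    (loc₂ : SelRel →ₗ[A] D₂) (locS : SelRel →ₗ[A] DS)
    (ld₂ : H →ₗ[A] P₀) (ldS : H →ₗ[A] PS)
    -- EH = `stub_reciprocity`, SelRel-wide
    (hEH : ∀ (x : H) (s : SelRel), c₂ (ld₂ x) (loc₂ s) + cS (ldS x) (locS s) = 0)
    -- S4₂ = `stub_deepHalfAtTwoStrict`: output has `S₀`-value zero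
    (h2 : ∀ z : P₀, (∀ s : SelRel, c₂ z (loc₂ s) = 0) →
      ∃ a : A, a ≠ 0 ∧ ∃ x : H, ldS x = 0 ∧ a • z = ld₂ x)
    -- S4₀ = `stub_deepHalfAwayTwo`: tested only on the strict-at-2 relaxed classes `ker loc₂`
    (h0 : ∀ χ : PS, (∀ s : SelRel, loc₂ s = 0 → cS χ (locS s) = 0) →
      ∃ a : A, a ≠ 0 ∧ ∃ x : H, a • χ = ldS x) :
    ∀ t : P₀ × PS, (∀ s : SelRel, c₂ t.1 (loc₂ s) + cS t.2 (locS s) = 0) →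
      ∃ a : A, a ≠ 0 ∧ ∃ x : H, a • t = (ld₂.prod ldS) x := by
  rintro ⟨z, χ⟩ ht
  -- `StrictKilled` is definitional here: `loc₂ s = 0 ⟹ c₂ z (loc₂ s) = 0`
  have hχ : ∀ s : SelRel, loc₂ s = 0 → cS χ (locS s) = 0 := by
    intro s hs
    have h := ht s
    rw [hs, map_zero, zero_add] at h
    exact h
  obtain ⟨a₀, ha₀, x₀, hx₀⟩ := h0 χ hχ
  -- correct `z` by `x₀`: `a₀ • z - ld₂ x₀` kills `loc₂(SelRel)` (orthogonality at `a₀ • s` + reciprocity for `x₀`)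
  have hz' : ∀ s : SelRel, c₂ (a₀ • z - ld₂ x₀) (loc₂ s) = 0 := by
    intro s
    have h1 : c₂ z (loc₂ (a₀ • s)) + cS χ (locS (a₀ • s)) = 0 := ht (a₀ • s)
    rw [map_smul loc₂ a₀ s, map_smul locS a₀ s] at h1
    have h2 : c₂ (ld₂ x₀) (loc₂ s) + cS (ldS x₀) (locS s) = 0 := hEH x₀ s
    rw [← hx₀, map_smul cS a₀ χ, CharacterModule.smul_apply] at h2
    -- values carry no `A`-action: unfold the pointwise subtraction and the contravariant smul by hand
    have e0 : c₂ (a₀ • z - ld₂ x₀) (loc₂ s) = (c₂ z) (a₀ • loc₂ s) - (c₂ (ld₂ x₀)) (loc₂ s) := by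
      rw [map_sub c₂, map_smul c₂ a₀ z]
      rfl
    have e1 : c₂ z (a₀ • loc₂ s) = -cS χ (a₀ • locS s) := eq_neg_of_add_eq_zero_left h1
    have e2 : c₂ (ld₂ x₀) (loc₂ s) = -cS χ (a₀ • locS s) := eq_neg_of_add_eq_zero_left h2
    rw [e0, e1, e2, sub_self]
  obtain ⟨a₁, ha₁, x₁, hx₁S, hx₁⟩ := h2 _ hz'
  refine ⟨a₁ * a₀, mul_ne_zero ha₁ ha₀, a₁ • x₀ + x₁, ?_⟩
  refine Prod.ext ?_ ?_
  · show (a₁ * a₀) • z = ld₂ (a₁ • x₀ + x₁)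
    rw [mul_smul, map_add, map_smul, ← hx₁, smul_sub, add_sub_cancel]
  · show (a₁ * a₀) • χ = ldS (a₁ • x₀ + x₁)
    rw [mul_smul, hx₀, map_add, map_smul, hx₁S, add_zero]

/-- **U37′.** The converse slice at `2` (`χ = 0`): `hDHrel` ⟹ S4₂, no hypothesis. [folklore] -/
theorem atTwo_of_hDHrel
    (c₂ : P₀ →ₗ[A] CharacterModule D₂) (cS : PS →ₗ[A] CharacterModule DS)
    (loc₂ : SelRel →ₗ[A] D₂) (locS : SelRel →ₗ[A] DS)
    (ld₂ : H →ₗ[A] P₀) (ldS : H →ₗ[A] PS)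
    (hDHrel : ∀ t : P₀ × PS, (∀ s : SelRel, c₂ t.1 (loc₂ s) + cS t.2 (locS s) = 0) →
      ∃ a : A, a ≠ 0 ∧ ∃ x : H, a • t = (ld₂.prod ldS) x) :
    ∀ z : P₀, (∀ s : SelRel, c₂ z (loc₂ s) = 0) →
      ∃ a : A, a ≠ 0 ∧ ∃ x : H, ldS x = 0 ∧ a • z = ld₂ x := by
  intro z hz
  obtain ⟨a, ha, x, hx⟩ := hDHrel (z, 0) fun s ↦ by
    show c₂ z (loc₂ s) + cS 0 (locS s) = 0
    rw [hz s, map_zero, zero_add]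
    rfl
  have h1 : a • z = ld₂ x := by simpa using congrArg Prod.fst hx
  have h2 : (a • (0 : PS)) = ldS x := by simpa using congrArg Prod.snd hx
  exact ⟨a, ha, x, by rw [← h2, smul_zero], h1⟩

/-- **U38.** SelRel-wide reciprocity ⟹ `pair (locd x) = 0` for every global family `x` (so p673478's `(EH_Z)` for
any `Z ≤ H`), under p673742's `hcompat` / `hloc` with `loc' := ld₂.prod ldS`. [folklore] -/
theorem pair_locd_eq_zero_of_reciprocity
    (c₂ : P₀ →ₗ[A] CharacterModule D₂) (cS : PS →ₗ[A] CharacterModule DS)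
    (loc₂ : SelRel →ₗ[A] D₂) (locS : SelRel →ₗ[A] DS)
    (ld₂ : H →ₗ[A] P₀) (ldS : H →ₗ[A] PS)
    (Sg : Submodule A SelRel) (π : (P₀ × PS) →ₗ[A] P) (pair : P →ₗ[A] CharacterModule Sg)
    (hcompat : ∀ (t : P₀ × PS) (s : Sg), pair (π t) s = c₂ t.1 (loc₂ s) + cS t.2 (locS s))
    (locd : H →ₗ[A] P) (hloc : ∀ x, locd x = π ((ld₂.prod ldS) x))
    (hEH : ∀ (x : H) (s : SelRel), c₂ (ld₂ x) (loc₂ s) + cS (ldS x) (locS s) = 0) :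
    ∀ x : H, pair (locd x) = 0 := by
  intro x
  ext s
  rw [hloc, hcompat]
  exact hEH x s

end Summit.BirchSwinnertonDyer.BirchSwinnertonDyer.Cruxes.ResidualThetaCountLowerPureAtTwo.ScritG12
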